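import Summits.FinalStateConjecture.FinalStateConjecture.Theses.ClusterCompleteness
import Summits.FinalStateConjecture.FinalStateConjecture.Theorems.StarvedNecksHonestFixedRadiusSettlingStubFlatZoneSojourn
import Summits.FinalStateConjecture.FinalStateConjecture.Theorems.StarvedNecksHonestFixedRadiusSettlingStubEntryBookkeeping

/-!
# Crux `LinearToNonlinearCapture` (stmt-FinalStateConjecture-14526), line `exterior-entry-capture`
# — stub S_C `stub_scriOfEntry`: the entering-half plumbing of the scri column

Registered sub-goal `stub_scriOfEntry` of the skeleton `Lines/exterior_entry_capture.lean` (lead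
prover `prover-line-stmt-FinalStateConjecture-14526-c12-0`, 2026-08-17). A maximal vacuum Cauchy
development of admissible data which is FAR-EXTERIOR NULL COMPLETE (a compact `K ⊆ Σ` such that
every normalised null ray from `Σ` never entering `J⁺(ι K)` is future complete — the conclusion of
stub S_A) and has ENTRY EVENTS of far rays into a settled flat chart (the conclusion of stub S_B:
for every compact `Bₑ` a compact `B₀ ⊇ Bₑ`, a final-state decomposition `d`, a Doppler bound `L`
and for all `τ, T` a compact `B₁` beyond which every normalised null ray entering `J⁺(ι B₀)` is
complete or has a flat-charted point of chart time `≥ τ` in `J⁺(ι B₀)` with chart velocity `dΦ w`,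
`0 < w⁰ ≤ L`, and the height-`T` coordinate cone over it inside the flat domain) has complete
future null infinity in Christodoulou's sojourn form (`Summit.FinalStateConjecture.HasCompleteNullInfinity`).

Proof: `B₀` from the entry statement at `Bₑ := K`; given `s > 0`, `δ := min δ₀ (1/(2CLs))`,
lateness `τδ` from `d.tendsto_deviationCk_flat`, `T := 1/(Cδ)`, `B₁ := B₁(τδ, T)`. A ray from
outside `B₁` AVOIDING `J⁺(ι B₀) ⊇ J⁺(ι K)` is complete by far completeness; an ENTERING non-complete
ray has an entry event, its velocity there is null (propagation along the geodesic), the LANDED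
rate-free flat-zone sojourn lever `StarvedNecks.OneOverDelta.stub_flatZoneSojourn` keeps
`[s₀, s₀ + (1 − e⁻¹)/(CδL)] ⊇ [s₀, s₀ + s]` inside the domain, and from `s₀` on the ray stays in
`J⁺(ι B₀)` (`J⁺ ∘ J⁺ = J⁺`). This is the proof of `scriComplete_of_radiationZoneEntry` (p112248)
read per development, plus the avoiding/entering case split.
-/

noncomputable section

namespace Summit.FinalStateConjecture.FinalStateConjecture.Theorems

open scoped BigOperators Topology Manifold ENNReal ContDiff
open Filter Set Function TopologicalSpace Bundle MeasureTheory
open Literature.Geometry.Lorentzian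
open Summit.FinalStateConjecture.FinalStateConjecture.Theses.ClusterCompleteness
open Summit.FinalStateConjecture.FinalStateConjecture.Theorems.StarvedNecks.OneOverDelta

set_option linter.dupNamespace false in
-- nested operator types `E4 →L[ℝ] E4 →L[ℝ] E4 →L[ℝ] ℝ` (as in the StarvedNecks lever file)
set_option maxSynthPendingDepth 3 in
/-- **Stub S_C (`stub_scriOfEntry`; the entering-half plumbing).** A maximal vacuum Cauchy
development of admissible data which is far-exterior null complete and has entry events in the
sense of stub S_B (`stub_radiationZoneEntry`) has complete future null infinity in Christodoulou's
sojourn form: `B₀` from the entry statement at `Bₑ := K`; a ray from outside `B₁` avoiding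
`J⁺(ι B₀) ⊇ J⁺(ι K)` is complete by far completeness; an entering, non-complete ray has an entry
event, its velocity there is null, and the landed rate-free flat-zone sojourn lever
(`StarvedNecks.OneOverDelta.stub_flatZoneSojourn`, one-sided Grönwall on `log ẋ⁰`) with
`δ := min δ₀ (1/(2CLs))`, `T := 1/(Cδ)` and lateness from `d.tendsto_deviationCk_flat` keeps it
inside the flat domain, hence inside `J⁺(ι B₀)`, for affine time `≥ s`. -/
theorem stub_scriOfEntry :
    ∀ (X : Type) [TopologicalSpace X] [ChartedSpace E3 X] [IsManifold (𝓡 3) ∞ X] [T2Space X]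
      [SecondCountableTopology X] [ConnectedSpace X], ∀ D ∈ admissibleVacuumData X, ∀ 𝒟 :
      VacuumCauchyDevelopment D, 𝒟.IsMaximal → (∀ [𝒟.metric.HasLeviCivita], ∃ K : Set X, IsCompact K
      ∧ ∀ (p : X) (γ : ℝ → 𝒟.carrier) (dom : Set ℝ), 𝒟.metric.IsNormalisedNullRayFrom
      𝒟.timeOrientation 𝒟.embed 𝒟.normal p γ dom → (∀ t ∈ dom, 0 ≤ t → γ t ∉ 𝒟.metric.causalFuture
      𝒟.timeOrientation (𝒟.embed '' K)) → ¬ BddAbove dom) → (∀ [𝒟.metric.HasLeviCivita], ∀ Bₑ : Set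
      X, IsCompact Bₑ → ∃ B₀ : Set X, IsCompact B₀ ∧ Bₑ ⊆ B₀ ∧ ∃ (O'' : Set 𝒟.carrier) (d :
      FinalStateDecomposition 𝒟.toSpacetime O'' 2) (L : ℝ), 0 < L ∧ ∀ τ T : ℝ, ∃ B₁ : Set X,
      IsCompact B₁ ∧ ∀ p ∉ B₁, ∀ (γ : ℝ → 𝒟.carrier) (dom : Set ℝ), 𝒟.metric.IsNormalisedNullRayFrom
      𝒟.timeOrientation 𝒟.embed 𝒟.normal p γ dom → (∃ t ∈ dom, 0 ≤ t ∧ γ t ∈ 𝒟.metric.causalFuture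
      𝒟.timeOrientation (𝒟.embed '' B₀)) → ¬ BddAbove dom ∨ ∃ (s₀ : ℝ) (y : d.flatDomain) (w : E4),
      s₀ ∈ dom ∧ 0 ≤ s₀ ∧ γ s₀ ∈ 𝒟.metric.causalFuture 𝒟.timeOrientation (𝒟.embed '' B₀) ∧ γ s₀ =
      d.flatChart y ∧ d.τ₀ < y.1 0 ∧ τ ≤ y.1 0 ∧ velocity (𝓡 4) γ s₀ = mfderiv 𝓘(ℝ, E4) (𝓡 4)
      d.flatChart y w ∧ 0 < w 0 ∧ w 0 ≤ L ∧ {z : E4 | y.1 0 ≤ z 0 ∧ z 0 ≤ y.1 0 + T ∧ ‖E4.spatial z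
      - E4.spatial y.1‖ ≤ 2 * (z 0 - y.1 0) + 1} ⊆ (d.flatDomain : Set E4)) →
      Summit.FinalStateConjecture.HasCompleteNullInfinity 𝒟.toCauchyDevelopment := by
  intro X _ _ _ _ _ _ D _hD 𝒟 _hmax hfar hent _
  obtain ⟨K, hK, hKfar⟩ := hfar
  obtain ⟨B₀, hB₀, hKB₀, O', d, L, hL, hE⟩ := hent K hK
  refine ⟨B₀, hB₀, fun s hs ↦ ?_⟩
  obtain ⟨C, hC, δ₀, hδ₀, hZ'⟩ := stub_flatZoneSojourn
  -- the deviation size and the chart time budget (as in `scriComplete_of_radiationZoneEntry`)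
  set δ : ℝ := min δ₀ (1 / (2 * C * L * s)) with hδ_def
  have hδ : 0 < δ := lt_min hδ₀ (by positivity)
  have hδle : δ ≤ δ₀ := min_le_left _ _
  have hδle' : δ ≤ 1 / (2 * C * L * s) := min_le_right _ _
  obtain ⟨τδ, hτδ⟩ : ∃ τδ : ℝ, ∀ τ', τδ ≤ τ' →
      𝒟.toSpacetime.deviationCk (Minkowski.backgroundOn d.flatDomain) d.flatChart 2 τ' ≤
        ENNReal.ofReal δ := by
    have h := (ENNReal.tendsto_nhds_zero.1 d.tendsto_deviationCk_flat) (ENNReal.ofReal δ)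
      (ENNReal.ofReal_pos.2 hδ)
    exact Filter.eventually_atTop.1 h
  set T : ℝ := 1 / (C * δ) with hT_def
  have hT : 0 ≤ T := by positivity
  have hCδT : C * δ * T = 1 := by
    rw [hT_def]
    field_simp
  obtain ⟨B₁, hB₁, hray⟩ := hE τδ T
  refine ⟨B₁, hB₁, fun p hp γ dom hγ ↦ ?_⟩
  by_cases hin : ∃ t ∈ dom, 0 ≤ t ∧
      γ t ∈ 𝒟.metric.causalFuture 𝒟.timeOrientation (𝒟.embed '' B₀)
  swap
  · -- a ray avoiding `J⁺(ι B₀) ⊇ J⁺(ι K)` is complete by far-exterior completeness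
    left
    push Not at hin
    exact hKfar p γ dom hγ fun t ht h0 hJK ↦
      hin t ht h0 (LorentzianMetric.causalFuture_mono (image_mono hKB₀) hJK)
  rcases hray p hp γ dom hγ hin with hcomplete | ⟨s₀, y, w, hs₀dom, hs₀, hJ, hγy, hlate, hτy,
    hvel, hw0, hwL, hcone⟩
  · exact Or.inl hcomplete
  right
  -- the velocity at the entry event is null (propagated along the null geodesic)
  have hnull : 𝒟.metric.IsNull (velocity (𝓡 4) γ s₀) := by
    haveI : CovariantDerivative.ContMDiffCovariantDerivative 𝒟.toSpacetime.metric.leviCivita 1 :=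
      Spacetime.contMDiffCovariantDerivative_leviCivita_one
    exact (hγ.1.isGeodesicOn.isNull_and_isFutureDirected_velocity 𝒟.toSpacetime.metric
      𝒟.toSpacetime.timeOrientation hγ.1.isOpen hγ.1.2.1 hγ.2.1 hγ.2.2.2.1 hγ.2.2.2.2.1
      hs₀dom).1
  have hdev : ∀ τ' : ℝ, y.1 0 ≤ τ' → τ' ≤ y.1 0 + T →
      𝒟.toSpacetime.deviationCk (Minkowski.backgroundOn d.flatDomain) d.flatChart 1 τ' ≤
        ENNReal.ofReal δ := by
    intro τ' h1 _
    exact le_trans (𝒟.toSpacetime.deviationCk_mono (Minkowski.backgroundOn d.flatDomain)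
      d.flatChart one_le_two τ') (hτδ τ' (hτy.trans h1))
  have hstay := hZ' X D 𝒟 O' 2 d γ dom hγ.isMaximalGeodesicOn s₀ y w L δ T hs₀dom hγy hlate hvel
    hnull hw0 hwL hδ hδle hT hdev hcone
  -- from `s₀` on the ray stays in `J⁺(ι B₀)`
  have hmem : ∀ t ∈ dom, s₀ ≤ t →
      γ t ∈ 𝒟.metric.causalFuture 𝒟.timeOrientation (𝒟.embed '' B₀) := by
    intro t ht hst
    have h2 := nullRay_apply_mem_causalFuture 𝒟.toSpacetime hγ.1 hγ.2.1 hγ.2.2.2.1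
      hγ.2.2.2.2.1 hs₀dom ht hst
    have h3 : γ t ∈ 𝒟.metric.causalFuture 𝒟.timeOrientation
        (𝒟.metric.causalFuture 𝒟.timeOrientation (𝒟.embed '' B₀)) :=
      LorentzianMetric.causalFuture_mono (singleton_subset_iff.2 hJ) h2
    rwa [LorentzianMetric.causalFuture_causalFuture_eq (WithTop.coe_le_coe.mpr le_top)] at h3
  -- the sojourn bound
  set b : ℝ := (1 - Real.exp (-(C * δ * T))) / (C * δ * L) with hb_def
  have hCδL : 0 < C * δ * L := by positivity
  have hb : s ≤ b := by
    rw [hb_def, le_div_iff₀ hCδL, hCδT]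
    have h1 : s * (C * δ * L) ≤ 1 / 2 := by
      calc s * (C * δ * L) = (s * C * L) * δ := by ring
        _ ≤ (s * C * L) * (1 / (2 * C * L * s)) := by gcongr
        _ = 1 / 2 := by field_simp
    have h2 : Real.exp (-1) ≤ 1 / 2 := by
      have h3 : (2 : ℝ) ≤ Real.exp 1 := by
        have := Real.add_one_le_exp (1 : ℝ)
        linarith
      rw [Real.exp_neg, one_div]
      exact inv_anti₀ (by norm_num) h3
    linarith
  calc ENNReal.ofReal s ≤ ENNReal.ofReal b := ENNReal.ofReal_le_ofReal hb
    _ = volume (Icc s₀ (s₀ + b)) := by rw [Real.volume_Icc, add_sub_cancel_left]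
    _ ≤ sojournTime γ dom (𝒟.metric.causalFuture 𝒟.timeOrientation (𝒟.embed '' B₀)) := by
      unfold sojournTime
      exact measure_mono fun t ht ↦
        ⟨hstay t ht.1 ht.2, hs₀.trans ht.1, hmem t (hstay t ht.1 ht.2) ht.1⟩

end Summit.FinalStateConjecture.FinalStateConjecture.Theorems

end
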